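import Mathlib
import Summits.Ventures.PercRepro.TriangleCapRegularCell

/-!
# PercRepro — THE CYCLIC BLOCK WITNESS: EVERY ROW-SIZE MULTISET OF THE REGULAR CELL IS REALISED
(p3, gen 54; part 288)

In the regular cell (`ℓ ≤ D` non-neighbours, every off-degree `≤ D`, `t = ℓ D`) the band value is
`bottom + ½ Σ_{rows} k (ℓ − k)` (part 287).  Conversely EVERY multiset of row sizes `1 ≤ k_m ≤ ℓ`, `m < N`, with
`Σ k_m = ℓ D` is realised: THE CYCLIC BLOCK WITNESS takes the left ends round robin `1, 2, …, ℓ, 1, 2, …` (every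
residue class has exactly `D` indices, so every non-neighbour has off-degree `D`) and lets the `m`-th block of
`k_m` consecutive indices share the leaf `ℓ + 1 + m` (consecutive indices have distinct residues: the rows are
sets).  `blockSum k m = Σ_{m' < m} k_{m'}`, `blockIdx k N i = #{m < N : blockSum k (m+1) ≤ i}` is the block of `i`
(`blockSum_blockIdx_le`, `lt_blockSum_blockIdx_succ`, `blockIdx_eq`), the class of the leaf `ℓ + 1 + m` is the
interval `[blockSum m, blockSum (m+1))` of size `k_m` (`cls_rfMulti`), `coll = Σ_m k_m (k_m − 1)` (`coll_rfMulti`),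
and two indices of one block with the same residue coincide (`eq_of_block_mod`).  THE WITNESS
(`regularMultiWitness`, `1 ≤ ℓ ≤ D`, `2 ℓ D ≤ s`): a triangle-free graph on `ℓ + 1 + (s − ℓ D)` vertices with `s`
edges, a vertex `w` of degree `s − ℓ D`, every off-degree `≤ D`, a non-neighbour of off-degree `D`, and the band
value `2 j = t (t − 1) − (ℓ D (D − 1) + Σ_{m < N} k_m (k_m − 1))`.  Part 289 turns it into the regular cell as a
set.  Axioms: standard.
-/

namespace PercRepro

namespace TriangleCap

namespace C047

open Finset

/-- The partial sums of the block sizes. -/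
def blockSum (k : ℕ → ℕ) (m : ℕ) : ℕ := ∑ m' ∈ range m, k m'

/-- The block of the index `i`: the number of blocks ending at or before `i`. -/
def blockIdx (k : ℕ → ℕ) (N i : ℕ) : ℕ := ((range N).filter (fun m => blockSum k (m + 1) ≤ i)).card

/-- The right ends of the cyclic block witness: the `m`-th block shares the leaf `ℓ + 1 + m`. -/
def rfMulti (ℓ : ℕ) (k : ℕ → ℕ) (N i : ℕ) : ℕ := ℓ + 1 + blockIdx k N i

/-- `blockSum k 0 = 0`. -/
theorem blockSum_zero (k : ℕ → ℕ) : blockSum k 0 = 0 := by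
  unfold blockSum
  simp

/-- `blockSum k (m + 1) = blockSum k m + k m`. -/
theorem blockSum_succ (k : ℕ → ℕ) (m : ℕ) : blockSum k (m + 1) = blockSum k m + k m := by
  unfold blockSum
  rw [sum_range_succ]

/-- The partial sums are monotone. -/
theorem blockSum_mono (k : ℕ → ℕ) {m m' : ℕ} (h : m ≤ m') : blockSum k m ≤ blockSum k m' := by
  unfold blockSum
  exact sum_le_sum_of_subset (range_subset_range.mpr h)

/-- The partial sums are strictly monotone on the blocks of positive size. -/
theorem blockSum_lt_succ (k : ℕ → ℕ) (m : ℕ) (hk : 1 ≤ k m) : blockSum k m < blockSum k (m + 1) := by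
  rw [blockSum_succ]
  omega

/-- `N ≤ blockSum k N` when every block is nonempty. -/
theorem le_blockSum (k : ℕ → ℕ) (N : ℕ) (hk : ∀ m, m < N → 1 ≤ k m) : N ≤ blockSum k N := by
  unfold blockSum
  have : ∑ _m ∈ range N, 1 ≤ ∑ m ∈ range N, k m := sum_le_sum (fun m hm => hk m (mem_range.mp hm))
  rw [sum_const, card_range, smul_eq_mul, mul_one] at this
  exact this

/-- The block of `i` starts at or before `i`: `blockSum k (blockIdx k N i) ≤ i`. -/
theorem blockSum_blockIdx_le (k : ℕ → ℕ) (N i : ℕ) : blockSum k (blockIdx k N i) ≤ i := by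
  unfold blockIdx
  set F := (range N).filter (fun m => blockSum k (m + 1) ≤ i) with hF
  rcases F.eq_empty_or_nonempty with hFe | hFne
  · rw [hFe, card_empty, blockSum_zero]
    exact Nat.zero_le i
  · have hmax := F.max'_mem hFne
    have hmax2 : blockSum k (F.max' hFne + 1) ≤ i := (mem_filter.mp hmax).2
    have hsub : F ⊆ range (F.max' hFne + 1) := by
      intro m hm
      rw [mem_range]
      have := F.le_max' m hm
      omega
    have hcard := card_le_card hsub
    rw [card_range] at hcard
    exact le_trans (blockSum_mono k hcard) hmax2

/-- The block of `i` ends after `i`: `i < blockSum k (blockIdx k N i + 1)` when `i < blockSum k N`. -/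
theorem lt_blockSum_blockIdx_succ (k : ℕ → ℕ) (N i : ℕ) (hi : i < blockSum k N) :
    i < blockSum k (blockIdx k N i + 1) := by
  unfold blockIdx
  set F := (range N).filter (fun m => blockSum k (m + 1) ≤ i) with hF
  by_contra hcon
  have hcon' : blockSum k (F.card + 1) ≤ i := Nat.le_of_not_lt hcon
  obtain ⟨N', rfl⟩ : ∃ N', N = N' + 1 := by
    rcases Nat.eq_zero_or_pos N with rfl | h
    · rw [blockSum_zero] at hi
      omega
    · exact ⟨N - 1, by omega⟩
  have hcN : F.card < N' + 1 := by
    have hsub : F ⊆ range (N' + 1) := filter_subset _ _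
    have hne : F ≠ range (N' + 1) := by
      intro heq
      have hmem : N' ∈ F := by
        rw [heq, mem_range]
        omega
      have := (mem_filter.mp hmem).2
      omega
    have := card_lt_card (Finset.ssubset_iff_subset_ne.mpr ⟨hsub, hne⟩)
    rw [card_range] at this
    exact this
  have hsub : range (F.card + 1) ⊆ F := by
    intro m hm
    rw [mem_range] at hm
    exact mem_filter.mpr ⟨mem_range.mpr (by omega),
      le_trans (blockSum_mono k (by omega : m + 1 ≤ F.card + 1)) hcon'⟩
  have := card_le_card hsub
  rw [card_range] at this
  omega

/-- The block index is below `N` for `i < blockSum k N`. -/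
theorem blockIdx_lt (k : ℕ → ℕ) (N i : ℕ) (hi : i < blockSum k N) : blockIdx k N i < N := by
  by_contra h
  have h' : N ≤ blockIdx k N i := Nat.le_of_not_lt h
  have := blockSum_blockIdx_le k N i
  have := blockSum_mono k h'
  omega

/-- The block of `i` is determined by its interval. -/
theorem blockIdx_eq (k : ℕ → ℕ) (N i m : ℕ) (hm : m < N)
    (h1 : blockSum k m ≤ i) (h2 : i < blockSum k (m + 1)) : blockIdx k N i = m := by
  have hiN : i < blockSum k N := lt_of_lt_of_le h2 (blockSum_mono k hm)
  have hc1 := blockSum_blockIdx_le k N i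
  have hc2 := lt_blockSum_blockIdx_succ k N i hiN
  rcases lt_trichotomy (blockIdx k N i) m with hlt | heq | hgt
  · have := blockSum_mono k (show blockIdx k N i + 1 ≤ m by omega)
    omega
  · exact heq
  · have := blockSum_mono k (show m + 1 ≤ blockIdx k N i by omega)
    omega

/-- The class of the leaf `ℓ + 1 + m` (`m < N`) is the `m`-th block: `k m` pairs. -/
theorem cls_rfMulti (ℓ : ℕ) (k : ℕ → ℕ) (N m : ℕ) (hm : m < N) :
    ((range (blockSum k N)).filter (fun i => rfMulti ℓ k N i = ℓ + 1 + m)).card = k m := by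
  have hset : (range (blockSum k N)).filter (fun i => rfMulti ℓ k N i = ℓ + 1 + m) =
      Ico (blockSum k m) (blockSum k (m + 1)) := by
    ext i
    simp only [mem_filter, mem_range, mem_Ico]
    unfold rfMulti
    constructor
    · rintro ⟨hi, hv⟩
      have hb : blockIdx k N i = m := by omega
      have hc1 := blockSum_blockIdx_le k N i
      have hc2 := lt_blockSum_blockIdx_succ k N i hi
      rw [hb] at hc1 hc2
      exact ⟨hc1, hc2⟩
    · rintro ⟨h1, h2⟩
      have hiN : i < blockSum k N := lt_of_lt_of_le h2 (blockSum_mono k hm)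
      refine ⟨hiN, ?_⟩
      rw [blockIdx_eq k N i m hm h1 h2]
  rw [hset, Nat.card_Ico, blockSum_succ, Nat.add_sub_cancel_left]

/-- The bounds of `rfMulti`: `ℓ + 1 ≤ rfMulti i < ℓ + 1 + N` for `i < blockSum k N`. -/
theorem rfMulti_bounds (ℓ : ℕ) (k : ℕ → ℕ) (N i : ℕ) (hi : i < blockSum k N) :
    ℓ + 1 ≤ rfMulti ℓ k N i ∧ rfMulti ℓ k N i < ℓ + 1 + N := by
  unfold rfMulti
  have := blockIdx_lt k N i hi
  omega

/-- The collision count of the cyclic block witness: `Σ_{m < N} k m (k m − 1)`. -/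
theorem coll_rfMulti (ℓ : ℕ) (k : ℕ → ℕ) (N : ℕ) :
    coll (blockSum k N) (rfMulti ℓ k N) = ∑ m ∈ range N, k m * (k m - 1) := by
  rw [coll_eq_sum_cls (blockSum k N) (rfMulti ℓ k N) ((range N).image (fun m => ℓ + 1 + m)) (fun i hi => by
    rw [mem_image]
    have := rfMulti_bounds ℓ k N i hi
    exact ⟨rfMulti ℓ k N i - (ℓ + 1), mem_range.mpr (by omega), by omega⟩)]
  rw [sum_image (fun m _ m' _ h => by omega)]
  apply sum_congr rfl
  intro m hm
  unfold cls
  rw [cls_rfMulti ℓ k N m (mem_range.mp hm)]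

/-- Two indices of one block with the same residue mod `ℓ` coincide (a block has at most `ℓ` indices). -/
theorem eq_of_block_mod (ℓ : ℕ) (k : ℕ → ℕ) (N i i' : ℕ) (_hℓ : 0 < ℓ)
    (hkℓ : ∀ m, m < N → k m ≤ ℓ) (hi : i < blockSum k N) (hi' : i' < blockSum k N)
    (hb : blockIdx k N i = blockIdx k N i') (hmod : i % ℓ = i' % ℓ) : i = i' := by
  have h1 := blockSum_blockIdx_le k N i
  have h2 := lt_blockSum_blockIdx_succ k N i hi
  have h3 := blockSum_blockIdx_le k N i'
  have h4 := lt_blockSum_blockIdx_succ k N i' hi'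
  have hN := blockIdx_lt k N i hi
  rw [blockSum_succ] at h2 h4
  rw [hb] at h1 h2
  have hkm := hkℓ _ hN
  rw [hb] at hkm
  -- `|i − i'| < ℓ` and `i ≡ i' (mod ℓ)`
  have e1 := Nat.div_add_mod i ℓ
  have e2 := Nat.div_add_mod i' ℓ
  obtain ⟨q, hq⟩ : ∃ q, i / ℓ = q := ⟨_, rfl⟩
  obtain ⟨q', hq'⟩ : ∃ q', i' / ℓ = q' := ⟨_, rfl⟩
  obtain ⟨r, hr⟩ : ∃ r, i % ℓ = r := ⟨_, rfl⟩
  rw [hq, hr] at e1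
  rw [hq', ← hmod, hr] at e2
  have hqq : q = q' := by
    rcases lt_trichotomy q q' with hlt | heq | hgt
    · have : ℓ * (q + 1) ≤ ℓ * q' := Nat.mul_le_mul_left ℓ hlt
      rw [Nat.mul_succ] at this
      omega
    · exact heq
    · have : ℓ * (q' + 1) ≤ ℓ * q := Nat.mul_le_mul_left ℓ hgt
      rw [Nat.mul_succ] at this
      omega
  subst hqq
  omega

/-- The ends of the cyclic block witness are good. -/
theorem goodEnds_multi (s ℓ D : ℕ) (k : ℕ → ℕ) (N : ℕ) (hℓ : 1 ≤ ℓ) (hk : ∀ m, m < N → 1 ≤ k m)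
    (hkℓ : ∀ m, m < N → k m ≤ ℓ) (hsum : blockSum k N = ℓ * D) (hs : 2 * (ℓ * D) ≤ s) :
    GoodEnds (ℓ + 1 + (s - ℓ * D)) (ℓ + 1) (ℓ * D) (lfRR ℓ 0) (rfMulti ℓ k N) := by
  refine ⟨fun i _ => ?_, fun i hi => ?_, fun i i' hi hi' h1 h2 => ?_⟩
  · have := lfRR_bounds ℓ 0 i hℓ
    omega
  · rw [← hsum] at hi
    have := rfMulti_bounds ℓ k N i hi
    have hN := le_blockSum k N hk
    omega
  · unfold lfRR at h1
    rw [if_neg (by omega), if_neg (by omega)] at h1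
    unfold rfMulti at h2
    rw [← hsum] at hi hi'
    exact eq_of_block_mod ℓ k N i i' (by omega) hkℓ hi hi' (by omega) (by omega)

/-- **THE CYCLIC BLOCK WITNESS:** for `1 ≤ ℓ ≤ D`, row sizes `1 ≤ k m ≤ ℓ` (`m < N`) with `Σ k m = ℓ D`, and
`2 (ℓ D) ≤ s`, a triangle-free graph on `ℓ + 1 + (s − ℓ D)` vertices with `s` edges, a vertex `w` of degree
`s − ℓ D`, every off-degree `≤ D`, a non-neighbour of off-degree `D`, and the band value
`2 j = t (t − 1) − (ℓ D (D − 1) + Σ_{m < N} k m (k m − 1))`, `t = ℓ D`. -/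
theorem regularMultiWitness (s ℓ D : ℕ) (k : ℕ → ℕ) (N : ℕ) (hℓ : 1 ≤ ℓ) (hℓD : ℓ ≤ D)
    (hk : ∀ m, m < N → 1 ≤ k m) (hkℓ : ∀ m, m < N → k m ≤ ℓ) (hsum : ∑ m ∈ range N, k m = ℓ * D)
    (hs : 2 * (ℓ * D) ≤ s) :
    ∃ (H : SimpleGraph (Fin (ℓ + 1 + (s - ℓ * D)))) (_ : DecidableRel H.Adj), H.CliqueFree 3 ∧
      H.edgeFinset.card = s ∧ ∃ w, deg H w + ℓ * D = s ∧ (∀ v, offDeg H w v ≤ D) ∧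
        (∃ x, ¬ H.Adj w x ∧ offDeg H w x = D) ∧
        ∑ v, deg H v * deg H v + 2 * (ℓ * D * (s - ℓ * D - 1)) +
          (ℓ * D * (ℓ * D - 1) - (ℓ * (D * (D - 1)) + ∑ m ∈ range N, k m * (k m - 1))) = s * (s + 1) := by
  have hbs : blockSum k N = ℓ * D := hsum
  set n := ℓ + 1 + (s - ℓ * D) with hn
  have hn0 : 0 < n := by omega
  have hD1 : 1 ≤ D := by omega
  have ht0 : 0 < ℓ * D := Nat.mul_pos (by omega) (by omega)
  have hN : N ≤ ℓ * D := by
    have := le_blockSum k N hk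
    omega
  have hg := goodEnds_multi s ℓ D k N hℓ hk hkℓ hbs hs
  have hval := genWitness_missing_value n (ℓ + 1) s (ℓ * D) hn0 (lfRR ℓ 0) (rfMulti ℓ k N) hg (by omega)
    (by omega) (by omega) (by omega)
  have hatt : ((range (ℓ * D)).filter (fun i => rfMulti ℓ k N i < ℓ + 1 + (s - ℓ * D))).card = ℓ * D := by
    rw [filter_true_of_mem (fun i hi => by
      rw [mem_range, ← hbs] at hi
      have := rfMulti_bounds ℓ k N i hi
      omega), card_range]
  have hcl : coll (ℓ * D) (lfRR ℓ 0) = ℓ * (D * (D - 1)) := by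
    rw [coll_lfRR_zero ℓ (ℓ * D) (by omega), Nat.mul_div_cancel_left D (by omega), Nat.mul_mod_right,
      zero_mul, mul_zero, add_zero]
  have hcr : coll (ℓ * D) (rfMulti ℓ k N) = ∑ m ∈ range N, k m * (k m - 1) := by
    rw [← hbs]
    exact coll_rfMulti ℓ k N
  rw [hatt, hcl, hcr, Nat.sub_self, mul_zero, zero_add] at hval
  refine ⟨_, inferInstance, cliqueFree_of_bipSub _ _ (bipSub_missingGraph _ _),
    card_edges_missingGraph_genWitness n (ℓ + 1) s (ℓ * D) hn0 (lfRR ℓ 0) (rfMulti ℓ k N) hg (by omega)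
      (by omega) (by omega), fin' n hn0 0, ?_, ?_, ?_, hval⟩
  · rw [deg_missingGraph_genWitness_zero n (ℓ + 1) s (ℓ * D) hn0 (lfRR ℓ 0) (rfMulti ℓ k N) hg (by omega)
      (by omega)]
    omega
  · intro v
    have hv : v = fin' n hn0 v.val := Fin.ext (by rw [fin'_val n hn0 v.val v.isLt])
    rw [hv]
    by_cases hva : v.val < ℓ + 1
    · rw [offDeg_genWitness_left n (ℓ + 1) s (ℓ * D) hn0 (lfRR ℓ 0) (rfMulti ℓ k N) hg (by omega) v.val hva,
        cls_lfRR_regular ℓ D v.val (by omega)]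
      split_ifs <;> omega
    · rw [offDeg_genWitness_right n (ℓ + 1) s (ℓ * D) hn0 (lfRR ℓ 0) (rfMulti ℓ k N) hg (by omega) v.val
        (by omega) v.isLt]
      by_cases hvb : v.val < ℓ + 1 + N
      · obtain ⟨m, hm⟩ : ∃ m, v.val = ℓ + 1 + m := ⟨v.val - (ℓ + 1), by omega⟩
        have hmN : m < N := by omega
        rw [hm, ← hbs, cls_rfMulti ℓ k N m hmN]
        exact le_trans (hkℓ m hmN) hℓD
      · rw [card_eq_zero.mpr (filter_eq_empty_iff.mpr (fun i hi hv' => by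
          rw [mem_range, ← hbs] at hi
          have := rfMulti_bounds ℓ k N i hi
          omega))]
        omega
  · refine ⟨fin' n hn0 1, not_adj_genWitness_one n (ℓ + 1) s (ℓ * D) hn0 (lfRR ℓ 0) (rfMulti ℓ k N) (by omega)
      (by omega), ?_⟩
    rw [offDeg_genWitness_left n (ℓ + 1) s (ℓ * D) hn0 (lfRR ℓ 0) (rfMulti ℓ k N) hg (by omega) 1 (by omega),
      cls_lfRR_regular ℓ D 1 (by omega), if_pos ⟨le_rfl, hℓ⟩]

end C047

end TriangleCap

end PercRepro
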